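import Summits.NavierStokesRegularity.NavierStokesRegularity.Theorems.TypeICertificateLadderTargetDepletionLambPairing
import Summits.NavierStokesRegularity.NavierStokesRegularity.Theorems.TypeICertificateLadderTargetFlowwiseDepletionSlab
import HarnessLib

/-!
# `TypeIQuarterGate.EnvelopeQuarterLaw` (item stmt-NavierStokesRegularity-23844) — TOOLS: Gronwall at
# the quarter exponent, Young bookkeeping, the slice estimate

`--supports stmt-NavierStokesRegularity-23844` (first of two files; the item is closed in
`TypeIQuarterGateEnvelopeQuarterLaw.lean`).

* `gronwall_quarter` — if `φ ≥ 0` on `(t₁,T)` with `φ' ≤ aφ + φ/(4(T−t)) + K/√(T−t)³` then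
  `φ ≤ K'/√(T−t)` on `[(t₁+T)/2, T)` (the weight `e^{−a(t−t₁)}(T−t)^{1/4}` makes
  `e^{−a(t−t₁)}(T−t)^{1/4}φ − 4K(T−t)^{−1/4}` non-increasing; the singular exponent `1/4 < 1/2` is
  what lets the forcing `(T−t)^{−3/2}` integrate to the quarter rate).
* `young_budget` — `|S| ≤ (A₁+A₂)√W`, `W ≤ 2P` ⇒ `2S − 2νP ≤ 2(A₁²+A₂²)/ν`.
* `volume_cores_le` — `|⋃_{a∈σ} B(a,ρ)| ≤ #σ ρ³ |B(0,1)|`.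
* `slice_stretching_bound` — THE SLICE ESTIMATE: for a `C²` divergence-free `v` with the scar envelope
  `‖v(x)‖ ≤ C' + Σ_{a∈σ} C'/(‖x−a‖ + s)`, `‖Dv‖ ≤ G`, `curl v ∈ L²`, `|∇curl v|_F ∈ L²` and integrable
  stretching density, the stretching integral in Lamb form `∫⟪v, ω × curl ω⟫` (tree:
  `DepletionLadder.integral_stretching_eq_integral_inner_cross`) splits into the cores `⋃ B(a, λs)`
  (`‖v‖ ≤ C'(1+N/s)`, `‖ω‖ ≤ √6 G`, volume `N(λs)³|B₁|`) and their complement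
  (`‖v‖ ≤ C'(1+N/((λ+1)s))`), whence by Cauchy–Schwarz
  `|∫⟪ω, Dv ω⟫| ≤ (C'(1+N/((λ+1)s))‖ω‖₂ + C'(1+N/s)√6 G √(N(λs)³|B₁|)) ‖curl ω‖₂`.

HONEST FRAMING: elementary real analysis and one pointwise-split Cauchy–Schwarz estimate; nothing about
Navier–Stokes regularity or blow-up is claimed. [folklore]
-/

-- the problem directory repeats the summit name (`NavierStokesRegularity/NavierStokesRegularity`)
set_option linter.dupNamespace false

noncomputable section

open Set Filter MeasureTheory Topology Metric
open scoped RealInnerProductSpace ENNReal NNReal ContDiff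

namespace Summit.NavierStokesRegularity.NavierStokesRegularity.Theorems

namespace EnvelopeQuarterLaw

open Literature.Analysis.FluidPDE

/-! ### Step 5: Gronwall at the quarter exponent -/

/-- **Gronwall at the quarter exponent.** If `φ ≥ 0` is differentiable on `(t₁, T)` with
`φ' ≤ a φ + φ/(4(T−t)) + K/√(T−t)³` (`a, K ≥ 0`), then `φ(t) ≤ K'/√(T−t)` on `[(t₁+T)/2, T)`:
the function `e^{−a(t−t₁)} (T−t)^{1/4} φ(t) − 4K (T−t)^{−1/4}` is non-increasing. [folklore] -/
theorem gronwall_quarter {φ dφ : ℝ → ℝ} {t₁ T a K : ℝ} (ht₁T : t₁ < T) (ha : 0 ≤ a) (hK : 0 ≤ K)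
    (hφ0 : ∀ t ∈ Ioo t₁ T, 0 ≤ φ t) (hder : ∀ t ∈ Ioo t₁ T, HasDerivAt φ (dφ t) t)
    (hineq : ∀ t ∈ Ioo t₁ T,
      dφ t ≤ a * φ t + φ t / (4 * (T - t)) + K / Real.sqrt (T - t) ^ 3) :
    ∃ K' : ℝ, ∀ t ∈ Ico ((t₁ + T) / 2) T, φ t ≤ K' / Real.sqrt (T - t) := by
  -- auxiliary functions: `r = √(T−t)`, `q = (T−t)^{1/4}`, `E = e^{−a(t−t₁)}`
  set r : ℝ → ℝ := fun t => Real.sqrt (T - t) with hr_def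
  set q : ℝ → ℝ := fun t => Real.sqrt (Real.sqrt (T - t)) with hq_def
  set E : ℝ → ℝ := fun t => Real.exp (-(a * (t - t₁))) with hE_def
  set H : ℝ → ℝ := fun t => E t * q t * φ t - 4 * K * (q t)⁻¹ with hH_def
  have hr : ∀ t ∈ Ioo t₁ T, 0 < r t := fun t ht => Real.sqrt_pos.2 (by linarith [ht.2])
  have hq : ∀ t ∈ Ioo t₁ T, 0 < q t := fun t ht => Real.sqrt_pos.2 (hr t ht)
  have hq2 : ∀ t ∈ Ioo t₁ T, q t ^ 2 = r t := fun t ht => Real.sq_sqrt (hr t ht).le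
  have hr2 : ∀ t ∈ Ioo t₁ T, r t ^ 2 = T - t := fun t ht => Real.sq_sqrt (by linarith [ht.2])
  have hE : ∀ t, 0 < E t := fun t => Real.exp_pos _
  have hE1 : ∀ t ∈ Ioo t₁ T, E t ≤ 1 := fun t ht => by
    simp only [hE_def]
    rw [Real.exp_le_one_iff]
    nlinarith [ht.1]
  -- derivatives
  have hdr : ∀ t ∈ Ioo t₁ T, HasDerivAt r (-1 / (2 * r t)) t := by
    intro t ht
    have h : HasDerivAt (fun s => T - s) (-1) t := (hasDerivAt_id' t).const_sub T
    exact h.sqrt (by linarith [ht.2] : T - t ≠ 0)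
  have hdq : ∀ t ∈ Ioo t₁ T, HasDerivAt q (-1 / (2 * r t) / (2 * q t)) t := fun t ht =>
    (hdr t ht).sqrt (hr t ht).ne'
  have hdE : ∀ t, HasDerivAt E (E t * (-a)) t := by
    intro t
    have h1 : HasDerivAt (fun s : ℝ => s - t₁) 1 t := (hasDerivAt_id' t).sub_const t₁
    have h3 : HasDerivAt (fun s : ℝ => -(a * (s - t₁))) (-(a * 1)) t := (h1.const_mul a).neg
    exact h3.exp.congr_deriv (by ring)
  set dH : ℝ → ℝ := fun t =>
    E t * q t * (dφ t - a * φ t - φ t / (4 * (T - t))) - K / (r t * q t ^ 3) with hdH_def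
  have hdH : ∀ t ∈ Ioo t₁ T, HasDerivAt H (dH t) t := by
    intro t ht
    have h := (((hdE t).mul (hdq t ht)).mul (hder t ht)).sub
      (((hdq t ht).inv (hq t ht).ne').const_mul (4 * K))
    refine h.congr_deriv ?_
    have hq0 : q t ≠ 0 := (hq t ht).ne'
    have hr0 : r t ≠ 0 := (hr t ht).ne'
    simp only [hdH_def, Pi.mul_apply]
    rw [← hr2 t ht, ← hq2 t ht]
    field_simp
    ring
  -- `H` is non-increasing: `H' ≤ 0`
  have hdH0 : ∀ t ∈ Ioo t₁ T, dH t ≤ 0 := by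
    intro t ht
    have hq0 : 0 < q t := hq t ht
    have hr0 : 0 < r t := hr t ht
    have h1 : dφ t - a * φ t - φ t / (4 * (T - t)) ≤ K / r t ^ 3 := by linarith [hineq t ht]
    have h2 : E t * q t * (dφ t - a * φ t - φ t / (4 * (T - t))) ≤ E t * q t * (K / r t ^ 3) :=
      mul_le_mul_of_nonneg_left h1 (by positivity)
    have h3 : q t * (K / r t ^ 3) = K / (r t * q t ^ 3) := by
      rw [← hq2 t ht]
      field_simp
    have h4 : E t * (K / (r t * q t ^ 3)) ≤ K / (r t * q t ^ 3) :=
      mul_le_of_le_one_left (by positivity) (hE1 t ht)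
    calc dH t ≤ E t * q t * (K / r t ^ 3) - K / (r t * q t ^ 3) := by
          simp only [hdH_def]; linarith
      _ = E t * (K / (r t * q t ^ 3)) - K / (r t * q t ^ 3) := by rw [mul_assoc, h3]
      _ ≤ 0 := by linarith
  have hanti : AntitoneOn H (Ioo t₁ T) := by
    have hint : interior (Ioo t₁ T) = Ioo t₁ T := isOpen_Ioo.interior_eq
    refine antitoneOn_of_deriv_nonpos (convex_Ioo t₁ T)
      (fun t ht => (hdH t ht).continuousAt.continuousWithinAt) ?_ ?_
    · rw [hint]; exact fun t ht => (hdH t ht).differentiableAt.differentiableWithinAt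
    · rw [hint]; intro t ht; rw [(hdH t ht).deriv]; exact hdH0 t ht
  -- conclusion
  set t₂ : ℝ := (t₁ + T) / 2 with ht₂_def
  have ht₂ : t₂ ∈ Ioo t₁ T := ⟨by rw [ht₂_def]; linarith, by rw [ht₂_def]; linarith⟩
  set E₀ : ℝ := Real.exp (-(a * (T - t₁))) with hE₀_def
  have hE₀ : 0 < E₀ := Real.exp_pos _
  set qbar : ℝ := Real.sqrt (Real.sqrt (T - t₁)) with hqbar_def
  refine ⟨(|H t₂| * qbar + 4 * K) / E₀, fun t ht => ?_⟩
  have htI : t ∈ Ioo t₁ T := ⟨lt_of_lt_of_le ht₂.1 ht.1, ht.2⟩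
  have hq0 : 0 < q t := hq t htI
  have hr0 : 0 < r t := hr t htI
  have hφt : 0 ≤ φ t := hφ0 t htI
  have hHt : H t ≤ H t₂ := hanti ht₂ htI ht.1
  have hmain : E t * q t * φ t ≤ |H t₂| + 4 * K * (q t)⁻¹ := by
    have : E t * q t * φ t - 4 * K * (q t)⁻¹ ≤ |H t₂| := hHt.trans (le_abs_self _)
    linarith
  -- lower bounds `E t ≥ E₀`, and `q t ≤ qbar`
  have hEt : E₀ ≤ E t := by
    simp only [hE₀_def, hE_def]
    exact Real.exp_le_exp.2 (by nlinarith [ht.2.le])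
  have hqt : q t ≤ qbar := by
    simp only [hq_def, hqbar_def]
    exact Real.sqrt_le_sqrt (Real.sqrt_le_sqrt (by linarith [htI.1]))
  -- multiply through by `q t`: `E r φ ≤ |H t₂| q + 4K`
  have h1 : E t * r t * φ t ≤ |H t₂| * qbar + 4 * K := by
    have h := mul_le_mul_of_nonneg_left hmain hq0.le
    have e1 : q t * (E t * q t * φ t) = E t * r t * φ t := by rw [← hq2 t htI]; ring
    have e2 : q t * (|H t₂| + 4 * K * (q t)⁻¹) = |H t₂| * q t + 4 * K := by
      field_simp
    rw [e1, e2] at h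
    have h3 : |H t₂| * q t ≤ |H t₂| * qbar := mul_le_mul_of_nonneg_left hqt (abs_nonneg _)
    linarith
  have h2 : E₀ * r t * φ t ≤ |H t₂| * qbar + 4 * K := by
    have : E₀ * r t * φ t ≤ E t * r t * φ t := by
      have := mul_le_mul_of_nonneg_right hEt (mul_nonneg hr0.le hφt)
      nlinarith
    linarith
  rw [div_div, le_div_iff₀ (mul_pos hE₀ hr0)]
  simp only [hr_def] at h2 ⊢
  linarith

/-! ### Step 4: Young bookkeeping -/

/-- Young: `|S| ≤ (A₁ + A₂)√W`, `W ≤ 2P`, `P ≥ 0` give `2S − 2νP ≤ 2(A₁² + A₂²)/ν`. [folklore] -/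
theorem young_budget {S W P ν A₁ A₂ : ℝ} (hν : 0 < ν) (hA₁ : 0 ≤ A₁) (hA₂ : 0 ≤ A₂) (hP : 0 ≤ P)
    (hS : |S| ≤ (A₁ + A₂) * Real.sqrt W) (hW : W ≤ 2 * P) :
    2 * S - 2 * ν * P ≤ 2 * (A₁ ^ 2 + A₂ ^ 2) / ν := by
  set y : ℝ := Real.sqrt (2 * P) with hy
  have hy0 : 0 ≤ y := Real.sqrt_nonneg _
  have hy2 : y ^ 2 = 2 * P := Real.sq_sqrt (by linarith)
  have hS' : S ≤ (A₁ + A₂) * y :=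
    (le_abs_self S).trans (hS.trans (mul_le_mul_of_nonneg_left (Real.sqrt_le_sqrt hW) (by positivity)))
  have key : ν * (2 * (A₁ + A₂) * y - ν * y ^ 2) ≤ (A₁ + A₂) ^ 2 := by
    nlinarith [sq_nonneg (ν * y - (A₁ + A₂))]
  have key' : 2 * (A₁ + A₂) * y - ν * y ^ 2 ≤ (A₁ + A₂) ^ 2 / ν := by
    rw [le_div_iff₀ hν, mul_comm]; exact key
  have hsq : (A₁ + A₂) ^ 2 / ν ≤ 2 * (A₁ ^ 2 + A₂ ^ 2) / ν :=
    div_le_div_of_nonneg_right (by nlinarith [sq_nonneg (A₁ - A₂)]) hν.le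
  calc 2 * S - 2 * ν * P = 2 * S - ν * y ^ 2 := by rw [hy2]; ring
    _ ≤ 2 * (A₁ + A₂) * y - ν * y ^ 2 := by nlinarith
    _ ≤ 2 * (A₁ ^ 2 + A₂ ^ 2) / ν := key'.trans hsq


/-! ### Step 3: the slice estimate -/

/-- Volume of the cores: `|⋃_{a ∈ σ} B(a, ρ)| ≤ #σ · ρ³ · |B(0,1)|`. [folklore] -/
theorem volume_cores_le (σ : Finset (EuclideanSpace ℝ (Fin 3))) {ρ : ℝ} (hρ : 0 ≤ ρ) :
    volume (⋃ a ∈ σ, ball a ρ) ≤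
      ENNReal.ofReal (σ.card * (ρ ^ 3 * (volume (ball (0 : EuclideanSpace ℝ (Fin 3)) 1)).toReal)) := by
  have hB : volume (ball (0 : EuclideanSpace ℝ (Fin 3)) 1) < ⊤ := measure_ball_lt_top
  calc volume (⋃ a ∈ σ, ball a ρ) ≤ ∑ a ∈ σ, volume (ball a ρ) := measure_biUnion_finset_le σ _
    _ = ∑ a ∈ σ, ENNReal.ofReal (ρ ^ 3 * (volume (ball (0 : EuclideanSpace ℝ (Fin 3)) 1)).toReal) := by
        refine Finset.sum_congr rfl fun a _ => ?_
        rw [Measure.addHaar_ball volume a hρ, finrank_euclideanSpace_fin,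
          ENNReal.ofReal_mul (pow_nonneg hρ 3), ENNReal.ofReal_toReal hB.ne]
    _ = ENNReal.ofReal (σ.card * (ρ ^ 3 * (volume (ball (0 : EuclideanSpace ℝ (Fin 3)) 1)).toReal)) := by
        rw [Finset.sum_const, nsmul_eq_mul, ENNReal.ofReal_mul (Nat.cast_nonneg _),
          ENNReal.ofReal_natCast]

/-- **The slice estimate.** For a `C²` divergence-free `v : ℝ³ → ℝ³` with the scar envelope
`‖v(x)‖ ≤ C' + Σ_{a∈σ} C'/(‖x − a‖ + s)` (`C' ≥ 0`, `s > 0`), `‖Dv‖ ≤ G`, and `curl v ∈ L²`,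
`|∇ curl v|_F ∈ L²`, integrable stretching density: for every `λ ≥ 0`,
`|∫⟪ω, Dv ω⟫| ≤ (C'(1 + N/((λ+1)s)) ‖ω‖₂ + C'(1 + N/s) · √6 G · √(N (λs)³ |B(0,1)|)) · ‖curl ω‖₂`
(`ω = curl v`, `N = #σ`): the stretching integral in Lamb form `∫⟪v, ω × curl ω⟫` is split into the
cores `⋃ B(a, λs)` (where `‖v‖ ≤ C'(1+N/s)`, `‖ω‖ ≤ √6 G`) and their complement (where the envelope
gives `‖v‖ ≤ C'(1 + N/((λ+1)s))`), and Cauchy–Schwarz is applied to each piece. [folklore] -/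
theorem slice_stretching_bound {v : EuclideanSpace ℝ (Fin 3) → EuclideanSpace ℝ (Fin 3)}
    (hv : ContDiff ℝ 2 v) (hdiv : VectorCalculus.IsDivFree v)
    {σ : Finset (EuclideanSpace ℝ (Fin 3))} {C' s lam G : ℝ} (hC' : 0 ≤ C') (hs : 0 < s)
    (hlam : 0 ≤ lam)
    (henv : ∀ x, ‖v x‖ ≤ C' + ∑ a ∈ σ, C' / (‖x - a‖ + s))
    (hG : ∀ x, ‖fderiv ℝ v x‖ ≤ G)
    (iZ : Integrable (fun x => ‖curl v x‖ ^ 2))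
    (iA : Integrable (fun x => frobeniusNormSq (fderiv ℝ (curl v) x)))
    (iJ : Integrable (fun x => ⟪curl v x, fderiv ℝ v x (curl v x)⟫)) :
    |∫ x, ⟪curl v x, fderiv ℝ v x (curl v x)⟫| ≤
      (C' * (1 + σ.card / ((lam + 1) * s)) * Real.sqrt (∫ x, ‖curl v x‖ ^ 2) +
          C' * (1 + σ.card / s) * (Real.sqrt 6 * G) *
            Real.sqrt (σ.card * ((lam * s) ^ 3 *
              (volume (ball (0 : EuclideanSpace ℝ (Fin 3)) 1)).toReal))) *
        Real.sqrt (∫ x, ‖curl (curl v) x‖ ^ 2) := by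
  -- abbreviations
  set N : ℝ := (σ.card : ℝ) with hN_def
  set V₁ : ℝ := (volume (ball (0 : EuclideanSpace ℝ (Fin 3)) 1)).toReal with hV₁_def
  set m : ℝ := C' * (1 + N / ((lam + 1) * s)) with hm_def
  set M : ℝ := C' * (1 + N / s) with hM_def
  set core : Set (EuclideanSpace ℝ (Fin 3)) := ⋃ a ∈ σ, ball a (lam * s) with hcore_def
  have hN0 : 0 ≤ N := Nat.cast_nonneg _
  have hG0 : 0 ≤ G := (norm_nonneg _).trans (hG 0)
  have hm0 : 0 ≤ m := by positivity
  have hM0 : 0 ≤ M := by positivity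
  have hV₁ : 0 ≤ V₁ := ENNReal.toReal_nonneg
  -- measurability and volume of the cores
  have hmeas : MeasurableSet core := Finset.measurableSet_biUnion σ fun a _ => measurableSet_ball
  have hvol : volume core ≤ ENNReal.ofReal (N * ((lam * s) ^ 3 * V₁)) :=
    volume_cores_le σ (by positivity)
  have hvol_top : volume core ≠ ⊤ := (hvol.trans_lt ENNReal.ofReal_lt_top).ne
  have hvol_real : (volume core).toReal ≤ N * ((lam * s) ^ 3 * V₁) :=
    ENNReal.toReal_le_of_le_ofReal (by positivity) hvol
  -- pointwise velocity bounds: everywhere, and off the cores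
  have hMx : ∀ x, ‖v x‖ ≤ M := by
    intro x
    refine (henv x).trans ?_
    have h := Finset.sum_le_card_nsmul σ (fun a => C' / (‖x - a‖ + s)) (C' / s)
      (fun a _ => div_le_div_of_nonneg_left hC' hs (le_add_of_nonneg_left (norm_nonneg _)))
    rw [nsmul_eq_mul] at h
    have : C' + ↑σ.card * (C' / s) = M := by simp only [hM_def, hN_def]; ring
    linarith
  have hmx : ∀ x, x ∉ core → ‖v x‖ ≤ m := by
    intro x hx
    have hfar : ∀ a ∈ σ, lam * s ≤ ‖x - a‖ := by
      intro a ha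
      by_contra hlt
      push Not at hlt
      exact hx (Set.mem_iUnion₂.2 ⟨a, ha, mem_ball_iff_norm.2 hlt⟩)
    refine (henv x).trans ?_
    have hls : 0 < (lam + 1) * s := by positivity
    have h := Finset.sum_le_card_nsmul σ (fun a => C' / (‖x - a‖ + s)) (C' / ((lam + 1) * s))
      (fun a ha => div_le_div_of_nonneg_left hC' hls (by nlinarith [hfar a ha]))
    rw [nsmul_eq_mul] at h
    have : C' + ↑σ.card * (C' / ((lam + 1) * s)) = m := by simp only [hm_def, hN_def]; ring
    linarith
  -- the vorticity is bounded by `√6 G`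
  have hωx : ∀ x, ‖curl v x‖ ≤ Real.sqrt 6 * G := by
    intro x
    have h1 : ‖curl v x‖ ^ 2 ≤ (Real.sqrt 6 * G) ^ 2 := by
      calc ‖curl v x‖ ^ 2 ≤ 2 * frobeniusNormSq (fderiv ℝ v x) :=
            norm_curl_sq_le_two_mul_frobeniusNormSq v x
        _ ≤ 2 * (3 * ‖fderiv ℝ v x‖ ^ 2) := by
            gcongr; exact frobeniusNormSq_le_three_mul _
        _ ≤ 2 * (3 * G ^ 2) := by
            gcongr; exact hG x
        _ = (Real.sqrt 6 * G) ^ 2 := by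
            rw [mul_pow, Real.sq_sqrt (by norm_num)]; ring
    exact (sq_le_sq₀ (norm_nonneg _) (by positivity)).1 h1
  -- Lamb form of the stretching integral
  rw [DepletionLadder.integral_stretching_eq_integral_inner_cross hv hdiv hMx iZ iA iJ]
  -- `L²` memberships
  have mω : MemLp (fun x => ‖curl v x‖) 2 volume := DepletionLadder.memLp_two_norm_curl hv iZ
  have mcω : MemLp (fun x => ‖curl (curl v) x‖) 2 volume :=
    DepletionLadder.memLp_two_norm_curl_curl hv iA
  set c : ℝ := M * (Real.sqrt 6 * G) with hc_def
  have hc0 : 0 ≤ c := by positivity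
  have mind : MemLp (core.indicator fun _ => c) 2 volume :=
    memLp_indicator_const 2 hmeas c (Or.inr hvol_top)
  -- the pointwise bound of the Lamb density
  have hpt : ∀ x, ‖⟪v x, cross (curl v x) (curl (curl v) x)⟫‖ ≤
      m * (‖(fun y => ‖curl v y‖) x‖ * ‖(fun y => ‖curl (curl v) y‖) x‖) +
        ‖core.indicator (fun _ => c) x‖ * ‖(fun y => ‖curl (curl v) y‖) x‖ := by
    intro x
    simp only [norm_norm]
    have hcross : ‖cross (curl v x) (curl (curl v) x)‖ ≤ ‖curl v x‖ * ‖curl (curl v) x‖ := by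
      rw [norm_cross]
      exact mul_le_of_le_one_right (by positivity) (Real.sin_le_one _)
    have h0 : ‖⟪v x, cross (curl v x) (curl (curl v) x)⟫‖ ≤
        ‖v x‖ * (‖curl v x‖ * ‖curl (curl v) x‖) :=
      (norm_inner_le_norm _ _).trans (mul_le_mul_of_nonneg_left hcross (norm_nonneg _))
    by_cases hx : x ∈ core
    · rw [Set.indicator_of_mem hx, Real.norm_of_nonneg hc0]
      have h1 : ‖v x‖ * (‖curl v x‖ * ‖curl (curl v) x‖) ≤ c * ‖curl (curl v) x‖ := by
        rw [← mul_assoc, hc_def]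
        exact mul_le_mul_of_nonneg_right
          (mul_le_mul (hMx x) (hωx x) (norm_nonneg _) hM0) (norm_nonneg _)
      have h2 : 0 ≤ m * (‖curl v x‖ * ‖curl (curl v) x‖) := by positivity
      linarith
    · rw [Set.indicator_of_notMem hx, norm_zero, zero_mul, add_zero]
      exact h0.trans (mul_le_mul_of_nonneg_right (hmx x hx) (by positivity))
  -- integrate
  have iprod : Integrable (fun x => ‖(fun y => ‖curl v y‖) x‖ * ‖(fun y => ‖curl (curl v) y‖) x‖) :=
    mω.norm.integrable_mul mcω.norm
  have iind : Integrable
      (fun x => ‖core.indicator (fun _ => c) x‖ * ‖(fun y => ‖curl (curl v) y‖) x‖) :=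
    mind.norm.integrable_mul mcω.norm
  have hI : ‖∫ x, ⟪v x, cross (curl v x) (curl (curl v) x)⟫‖ ≤
      ∫ x, (m * (‖(fun y => ‖curl v y‖) x‖ * ‖(fun y => ‖curl (curl v) y‖) x‖) +
        ‖core.indicator (fun _ => c) x‖ * ‖(fun y => ‖curl (curl v) y‖) x‖) :=
    norm_integral_le_of_norm_le ((iprod.const_mul m).add iind) (Eventually.of_forall hpt)
  rw [integral_add (iprod.const_mul m) iind, integral_const_mul] at hI
  -- Cauchy–Schwarz, twice
  have hCS1 := integral_norm_mul_norm_le_sqrt_mul_sqrt mω mcω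
  have hCS2 := integral_norm_mul_norm_le_sqrt_mul_sqrt mind mcω
  simp only [norm_norm] at hCS1 hCS2 hI
  -- the indicator integral
  have hind : ∫ x, ‖core.indicator (fun _ => c) x‖ ^ 2 = c ^ 2 * (volume core).toReal := by
    have : (fun x => ‖core.indicator (fun _ => c) x‖ ^ 2) = core.indicator (fun _ => c ^ 2) := by
      funext x
      by_cases hx : x ∈ core
      · simp [Set.indicator_of_mem hx]
      · simp [Set.indicator_of_notMem hx]
    rw [this, integral_indicator_const _ hmeas, smul_eq_mul, mul_comm, measureReal_def]
  have hsq : Real.sqrt (∫ x, ‖core.indicator (fun _ => c) x‖ ^ 2) ≤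
      c * Real.sqrt (N * ((lam * s) ^ 3 * V₁)) := by
    rw [hind, Real.sqrt_mul (sq_nonneg c), Real.sqrt_sq hc0]
    exact mul_le_mul_of_nonneg_left (Real.sqrt_le_sqrt hvol_real) hc0
  have h2nd : ∫ x, ‖core.indicator (fun _ => c) x‖ * ‖curl (curl v) x‖ ≤
      c * Real.sqrt (N * ((lam * s) ^ 3 * V₁)) * Real.sqrt (∫ x, ‖curl (curl v) x‖ ^ 2) :=
    hCS2.trans (mul_le_mul_of_nonneg_right hsq (Real.sqrt_nonneg _))
  have h1st : m * ∫ x, ‖curl v x‖ * ‖curl (curl v) x‖ ≤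
      m * (Real.sqrt (∫ x, ‖curl v x‖ ^ 2) * Real.sqrt (∫ x, ‖curl (curl v) x‖ ^ 2)) :=
    mul_le_mul_of_nonneg_left hCS1 hm0
  rw [← Real.norm_eq_abs]
  calc ‖∫ x, ⟪v x, cross (curl v x) (curl (curl v) x)⟫‖
      ≤ (m * ∫ x, ‖curl v x‖ * ‖curl (curl v) x‖) +
          ∫ x, ‖core.indicator (fun _ => c) x‖ * ‖curl (curl v) x‖ := hI
    _ ≤ m * (Real.sqrt (∫ x, ‖curl v x‖ ^ 2) * Real.sqrt (∫ x, ‖curl (curl v) x‖ ^ 2)) +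
          c * Real.sqrt (N * ((lam * s) ^ 3 * V₁)) * Real.sqrt (∫ x, ‖curl (curl v) x‖ ^ 2) :=
        add_le_add h1st h2nd
    _ = _ := by simp only [hc_def, hm_def, hM_def]; ring

end EnvelopeQuarterLaw

end Summit.NavierStokesRegularity.NavierStokesRegularity.Theorems

end
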